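import Literature.Probability.LatticeModels.HardCoreUrsell

/-!
# `Balaban1983to89.B3Eq121FirstBlock` — T. Bałaban, *(Higgs)₂,₃ quantum fields in a finite volume. III.
# Renormalization*, Commun. Math. Phys. **88** (1983) 411–445 [Balaban1983Higgs3], (1.21) p. 416: «Σ^ε, Σ^ε_1, Σ^ε_2 are
# given by amputated, one-particle-irreducible graphs of the expansion of G^ε» — THE FIRST ONE-PARTICLE-IRREDUCIBLE
# BLOCK OF A CONNECTED LABELLED TWO-POINT PAIRING, THE CUT BIJECTION, AND THE LABELLED RECURSION BEHIND (1.21)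
# (BRICK 9, FILE 1 of «amputation / 1PI / Dyson resummation FROM (1.19)» on the labelled carrier of BRICK 5)

statement-level skeleton of published theorems with citation tags; proofs where landed; nothing here is a claim about
the Yang–Mills mass gap

PDF held: `paper:balaban1983-higgs-2-3-quantum-fields-finite-volume` (journal page = PDF page + 410); p. 414 (PDF 4, L38–41)
and p. 416 (PDF 6, L12–21) read in the text layer this session (`lit read … --pages 4`), p. 415/416 on the ×2 renders
`run/shared/lean/pub/pub-balaban/b2b-balaban-ref1/pages/1983-cmp88-higgs23-III/…-p005/p006-x2.png` in gens 70–72.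

CITATION HEADER (lean-in-tree rule).  Part of the lit-balaban TYPED SKELETON (HOME `run/shared/lean/pub/lit-balaban/`),
Phase 2, proof seat p33 (gen 73, unit `lit-balaban-p33`; TAKING HOME/STATUS.md 2026-08-23T17:00:23Z, owner r15 g16
«WELCOME — PRIORITY YOURS» 17:02:01Z, cc p32/p37/p39); row **B3.Eq1.19-1.22** of `HOME/lit-balaban-r15/ROWS-B3.md` (fold owner
r15, referee ref-4; head `proved` under the lead's HEAD WORDS Q25/Q28/Q28′ — this file is an OPTIONAL located member, zero head
weight).  WHAT IS REPRODUCED: the combinatorial content of the element «amputation / 1PI / Dyson resummation FROM (1.19)»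
that the row's scope clause (v1.330) names as NOT in the tree, on the LABELLED carrier on which (1.19)'s perturbative
coefficients ARE theorems (BRICK 5 `B3Eq119ConnectedGraphs.iteratedDerivWithin_twoPointFamily_eq_sum_connected`: colourings
× CONNECTED labelled pairings of legs × `Π C₀^ε`; BRICK 6/FILE 3 at `e > 0`).  FILE 1 (this file) = pure finite combinatorics
of amputated two-point pairings; FILE 2 (next) = unrolling over ordered vertex partitions + relabelling invariance + the
exponential generating function ⇒ r15's `B3Sect1TwoPoint.Eq121`/`dysonTerm` and p32's `B3Eq121OnePIChains.greenSeries` BY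
NAME; FILE 3 = the instance on BRICK 5's `HiggsLattice` carrier at `e = 0`.  USED BY NAME, nothing re-declared: p13's set
partitions `Literature.Probability.LatticeModels.{IsSetPartition, setPartitions}` (`HardCoreUrsell`: `.union`, `.subset`,
`.eq_of_mem`, `isSetPartition_singleton`, …) and Mathlib's `Finset.inf'_mem`.  DISJOINT from, and importing nothing of,
p32's chain decomposition of p18's MODEL graphs (`B3OnePIChainDecomposition`/`…Pieces`/`…PieceGraphs`/`…Unglue`: `Sep`, `IsNear`,
`level`, pieces as `TwoLegGraph`s, isomorphism classes) and p37's cutting rule on p26's evaluator (`B3GraphGlue*`,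
`B3OnePIChainAmplitude.kernel_chain`): those files organise print's GRAPHS (objects up to isomorphism, pictures, degrees);
this file organises the LABELLED PAIRINGS that (1.19)'s derivatives are sums of — no dictionary between the two is claimed here.

THE PRINT (verbatim).  p. 416: «The function G^ε has a perturbative expansion of the following structure
G^ε = Σ_{n=0}^∞ C^ε_0[(−δm² + Σ^ε + ∂^{ε*}Σ^ε_1 + Σ^{ε*}_1∂^ε + ∂^{ε*}Σ^ε_2∂^ε)C^ε_0]ⁿ, (1.21) where C^ε_0 = (−Δ^ε_0 + m²)^{−1} and
Σ^ε, Σ^ε_1, Σ^ε_2 are given by amputated, one-particle-irreducible graphs of the expansion of G^ε.»  p. 415: «Now a graph for us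
is a collection of internal lines, external legs, and vertices connected in the usual sense.»  p. 414: «All the A′-legs are
contracted, i.e. they are divided into pairs and each pair is replaced by the corresponding propagator. Some φ′-legs are
replaced by external scalar fields and the remaining are again divided into pairs and each pair is replaced by a propagator
… Of course the whole expression is multiplied by a proper combinatorial factor connected with the number of ways given
expression can be obtained from Gaussian integrals in (1.5).»  Print does not define «one-particle-irreducible» nor prove
(1.21); the structure asserted is the textbook one (a connected two-point graph is a chain of 1PI insertions joined by single
lines; summing the chains gives the geometric series (1.21)).  On LABELLED pairings the «proper combinatorial factor» is the
labelled count itself (no symmetry factors), which is how (1.19)'s Taylor coefficients arise (BRICK 4/5).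

THE MODEL (ours; the objects of BRICK 5 abstracted).  A finite type of legs `Λ` with owners `own : Λ → V` (vertices) and a
finset `A ⊆ Λ` of active legs; `L_S = legsOf own A S` = the active legs owned in `S ⊆ V`.  An AMPUTATED TWO-POINT PAIRING on a
vertex set `U` (`IsAmp U a e μ`) is: an ENTRY leg `a ∈ L_U` (the leg to which the external field `φ(x)` of (1.19) contracts),
an EXIT leg `e ∈ L_U`, `e ≠ a` (contracted to `φ(x′)`), and a PERFECT MATCHING `μ` of `L_U ∖ {a, e}` (`IsPM`/`pmatchings`: set
partitions into pairs — p. 414 «divided into pairs»); its weight is `Π_{P ∈ μ} w P` for pair weights `w` (propagators), the two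
external propagators being stripped (amputation).  The CUT COUNT of a vertex subset `S` is `cut μ a e L_S` = #pairs crossing
`L_S` + [a ∈ L_S] + [e ∈ L_S] (lines leaving `S`, the two external lines included); `Conn` = every nonempty `S ∌ own a` is left
by a pair (p. 415 «connected», with `x`, `x′` attached); `OnePI` = connected and no proper `S ∋ own a` has cut count `2` (no
single line separates `x` from `x′` — «one-particle-irreducible» for amputated two-point graphs).  HYPOTHESIS THROUGHOUT THE
DECOMPOSITION: EVEN vertex degrees `hdeg` (every vertex of (1.20) has an even number of scalar legs: 4 for (1.6), 2 for (1.7);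
BRICK 5's observable is split into the two external points) — it makes every cut count even (`even_cut`).

THE ARGUMENT (ours; the standard «first self-energy insertion» proof of the Dyson equation, made finite and labelled).
§2: PARITY `cut(S) ≡ |L_S| (mod 2)` (`cut_mod_two`) and SUBMODULARITY `cut(S∩T) + cut(S∪T) ≤ cut(S) + cut(T)` (`cut_submod`,
pair by pair `crossInd_submod`) ⇒ the BLOCK FAMILY `{S ∋ own a : cut(S) = 2}` is closed under `∩` (`inter_mem_blockFamily`:
both sides are `≥ 2` by parity, the sum is `≤ 4`) and contains `U` ⇒ its minimum, the FIRST BLOCK `B = firstBlock`, belongs to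
it (`firstBlock_mem`, Mathlib's `Finset.inf'_mem`); `OnePI ⇔ firstBlock = U` (`onePI_iff_firstBlock_eq`).  §3: GLUING DATA
(`GlueData`: block `B`, exit leg `e₁ ∈ L_B`, next entry leg `a₂ ∈ L_{U∖B}`, matchings `μ₁`, `μ₂` of the other legs of `B`,
`U ∖ B`) and the glued pairing `glued = μ₁ ∪ μ₂ ∪ {{e₁, a₂}}`: it is a perfect matching of `L_U ∖ {a, e}` (`isPM_glued`), its
weight FACTORIZES `w{e₁,a₂}·Π_{μ₁}·Π_{μ₂}` (`prod_glued`), its only pair crossing `L_B` is the glued line (`exitPairs_glued`,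
hence `exitLeg_glued`/`nextLeg_glued`/`filter_glued₁/₂` recover the data), inside `B` its cut counts are the piece's
(`cut_glued_of_subset`); connectedness glues and un-glues (`conn_glued`, `conn_rest`, `conn_piece` — the last by parity: if the
glued line is the one entering `S ⊆ B`, an odd number of the piece's lines leave `S`), and `firstBlock(glued) = B ⇔ the piece is
1PI` (`firstBlock_glued`, `onePI_piece`, `not_onePI_glued`).  §4 `decompose`: a connected NOT 1PI pairing IS the gluing of its
piece on `B = firstBlock` (exit leg = the endpoint in `L_B` of the UNIQUE pair crossing `L_B`: `cut(B) = 2` and `e ∉ L_B` since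
otherwise `U ∖ B` would be closed, contradicting `Conn`) with its remainder; the piece is 1PI and the remainder connected
(`onePI_piece_conn_rest`).  §5: hence the CUT BIJECTION {connected, not 1PI on `U`} ≅ {(B, e₁, a₂, 1PI piece on `B`, connected
remainder on `U ∖ B`)} as a `Finset.sum_nbij'` identity (`sum_not_onePI_eq_sum_cutIndex`) and the RECURSION
(`ampSum_eq_kerSum_add`).

WHAT IS PROVED (0 `sorry`, no `Prop` fact; axioms `propext`, `Classical.choice`, `Quot.sound`).
* §1 `legsOf` (+ `_inter/_union/_sdiff/_mono`, `card_legsOf_eq_sum`, `even_card_legsOf`), `IsPM`/`pmatchings`/`mem_pmatchings`,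
  `crossInd`, `card_pair_inter_eq_one_iff`, **`crossInd_submod`**, `card_inter_mod_two`.
* §2 `cut`, **`cut_submod`**, `sum_card_inter_eq`, **`cut_mod_two`**; `IsAmp`, `Conn`, `blockFamily`, `OnePI`, `firstBlock`;
  `cut_self`, `self_mem_blockFamily`, **`even_cut`**, `two_le_cut`, **`inter_mem_blockFamily`**, **`firstBlock_mem`**,
  `firstBlock_subset`, `firstBlock_spec`, **`onePI_iff_firstBlock_eq`**.
* §3 `pick`, `exitPairs`, `sum_crossInd_eq_card`, `exitLeg`, `nextLeg`, `GlueData`, `glued`, `legs_disjoint`,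
  `GlueData.{legs_union, e₁_ne_a₂, card_line, pair_inter_legsB, pair_sdiff_legsB, isPM_glued, isAmp_glued, prod_glued,
  exitPairs_glued, exitLeg_glued, nextLeg_glued, filter_glued₁, filter_glued₂, cut_glued_of_subset, cut_glued_block,
  block_mem_blockFamily, conn_glued, conn_rest, conn_piece, firstBlock_glued, onePI_piece, not_onePI_glued}`,
  `card_inter_add_card_inter`.
* §4 **`decompose`**, `onePI_piece_conn_rest`.
* §5 `ampSet`/`kerSet`/`ampSum`/`kerSum` (`mem_ampSet`, `mem_kerSet`, `filter_onePI_ampSet`), `cutIndex`,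
  **`sum_not_onePI_eq_sum_cutIndex`**, and the headline **`ampSum_eq_kerSum_add`**:
  `𝒜_U(a,e) = K_U(a,e) + Σ_{B ⊆ U, own a ∈ B ∌ own e} Σ_{e₁ ∈ L_B∖{a}} Σ_{a₂ ∈ L_{U∖B}∖{e}} w{e₁,a₂} · K_B(a,e₁) · 𝒜_{U∖B}(a₂,e)`.
HONEST SCOPE.  (i) Pure finite combinatorics: no Gaussian, no lattice, no kernel — the pair weights `w` are arbitrary elements
of a commutative ring; the identification `w{l,l′} = C₀^ε(pos l, pos l′)`, the sum over entry/exit legs at given positions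
(the matrix form `𝒜 = K + Σ_B K·C₀·𝒜`), the unrolling into chains, the exponential generating function and (1.21) in r15's
`Eq121`/`dysonTerm` currency are FILES 2–3.  (ii) Even vertex degrees are ASSUMED (true for the vertices (1.6), (1.7) of
(1.20) at `e = 0`; at `e > 0` the vector legs need the type-split of FILE 3 `B3Eq119ChargedGraphs`, not done here).
(iii) «One-particle-irreducible» is formalized for AMPUTATED TWO-POINT pairings as «no single line separates the two external
points» (= p37's `IsProper` reading on graphs; the stronger «2-edge-connected» reading is not needed for (1.21)).  (iv) Labelled
pairings, no symmetry factors, no isomorphism classes; no estimate, nothing about `ε → 0`.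
-/

namespace Literature.MathematicalPhysics.QuantumFieldTheory.Balaban1983to89.B3Eq121FirstBlock

open Finset Literature.Probability.LatticeModels

variable {Λ : Type*} {V : Type*} [DecidableEq V]

/-! ## §1 Legs of a vertex set; perfect matchings; crossing pairs -/

/-- The active legs owned by the vertices of `S`: `L_S = {l ∈ A : own l ∈ S}`. [cite: Balaban1983Higgs3, (1.21) p.416] -/
def legsOf (own : Λ → V) (A : Finset Λ) (S : Finset V) : Finset Λ := A.filter fun l => own l ∈ S

section Legs

variable (own : Λ → V) (A : Finset Λ)

/-- [cite: Balaban1983Higgs3, (1.21) p.416] -/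
@[simp] theorem mem_legsOf {S : Finset V} {l : Λ} : l ∈ legsOf own A S ↔ l ∈ A ∧ own l ∈ S := mem_filter

/-- [cite: Balaban1983Higgs3, (1.21) p.416] -/
theorem legsOf_mono {S T : Finset V} (h : S ⊆ T) : legsOf own A S ⊆ legsOf own A T :=
  fun _ hl => (mem_legsOf own A).2 ⟨((mem_legsOf own A).1 hl).1, h ((mem_legsOf own A).1 hl).2⟩

/-- [cite: Balaban1983Higgs3, (1.21) p.416] -/
theorem disjoint_legsOf {S T : Finset V} (h : Disjoint S T) : Disjoint (legsOf own A S) (legsOf own A T) :=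
  disjoint_left.2 fun _ h1 h2 => disjoint_left.1 h ((mem_legsOf own A).1 h1).2 ((mem_legsOf own A).1 h2).2

/-- [cite: Balaban1983Higgs3, (1.21) p.416] -/
theorem legsOf_empty : legsOf own A (∅ : Finset V) = ∅ := by
  ext l; simp

/-- `|L_S| = Σ_{v ∈ S} deg v` where `deg v` is the number of active legs of `v`. [cite: Balaban1983Higgs3, (1.21) p.416] -/
theorem card_legsOf_eq_sum (S : Finset V) :
    (legsOf own A S).card = ∑ v ∈ S, (A.filter fun l => own l = v).card := by
  have H : ∀ l ∈ legsOf own A S, own l ∈ S := fun l hl => ((mem_legsOf own A).1 hl).2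
  rw [card_eq_sum_card_fiberwise H]
  refine sum_congr rfl fun v hv => ?_
  congr 1; ext l
  simp only [mem_filter, mem_legsOf]
  constructor
  · rintro ⟨⟨hA, -⟩, h⟩; exact ⟨hA, h⟩
  · rintro ⟨hA, h⟩; exact ⟨⟨hA, h ▸ hv⟩, h⟩

/-- Under EVEN vertex degrees every `|L_S|`, `S ⊆ U`, is even. [cite: Balaban1983Higgs3, (1.21) p.416] -/
theorem even_card_legsOf {U : Finset V} (hdeg : ∀ v ∈ U, Even (A.filter fun l => own l = v).card)
    {S : Finset V} (hS : S ⊆ U) : Even (legsOf own A S).card := by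
  rw [card_legsOf_eq_sum]
  exact even_sum _ fun v hv => hdeg v (hS hv)

variable [DecidableEq Λ]

/-- [cite: Balaban1983Higgs3, (1.21) p.416] -/
theorem legsOf_inter (S T : Finset V) : legsOf own A (S ∩ T) = legsOf own A S ∩ legsOf own A T := by
  ext l; simp only [mem_legsOf, mem_inter]; tauto

/-- [cite: Balaban1983Higgs3, (1.21) p.416] -/
theorem legsOf_union (S T : Finset V) : legsOf own A (S ∪ T) = legsOf own A S ∪ legsOf own A T := by
  ext l; simp only [mem_legsOf, mem_union]; tauto

/-- [cite: Balaban1983Higgs3, (1.21) p.416] -/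
theorem legsOf_sdiff (S T : Finset V) : legsOf own A (S \ T) = legsOf own A S \ legsOf own A T := by
  ext l; simp only [mem_legsOf, mem_sdiff]; tauto

end Legs

variable [DecidableEq Λ]


/-- `μ` is a PERFECT MATCHING of the finset `X`: a set partition of `X` into blocks of size two (p. 414: *"divided into pairs"*).
[cite: Balaban1983Higgs3, p.414] -/
def IsPM (X : Finset Λ) (μ : Finset (Finset Λ)) : Prop := IsSetPartition X μ ∧ ∀ P ∈ μ, P.card = 2

/-- [folklore] [cite: Balaban1983Higgs3, p.414] -/
instance (X : Finset Λ) (μ : Finset (Finset Λ)) : Decidable (IsPM X μ) := by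
  unfold IsPM; exact instDecidableAnd

/-- The finset of perfect matchings of `X`. [cite: Balaban1983Higgs3, p.414] -/
def pmatchings (X : Finset Λ) : Finset (Finset (Finset Λ)) := (setPartitions X).filter fun μ => ∀ P ∈ μ, P.card = 2

/-- [cite: Balaban1983Higgs3, p.414] -/
theorem mem_pmatchings {X : Finset Λ} {μ : Finset (Finset Λ)} : μ ∈ pmatchings X ↔ IsPM X μ := by
  rw [pmatchings, mem_filter, mem_setPartitions]; rfl

/-- A pair `P` CROSSES the leg set `T`: exactly one of its two legs lies in `T`. [cite: Balaban1983Higgs3, (1.21) p.416] -/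
def crossInd (T P : Finset Λ) : ℕ := if (P ∩ T).card = 1 then 1 else 0

/-- [cite: Balaban1983Higgs3, (1.21) p.416] -/
theorem crossInd_le_one (T P : Finset Λ) : crossInd T P ≤ 1 := by
  unfold crossInd; split_ifs <;> simp

/-- For a pair `{x, y}`: it crosses `T` iff exactly one of `x`, `y` is in `T`. [cite: Balaban1983Higgs3, (1.21) p.416] -/
theorem card_pair_inter_eq_one_iff {x y : Λ} (hxy : x ≠ y) (T : Finset Λ) :
    (({x, y} : Finset Λ) ∩ T).card = 1 ↔ (x ∈ T ↔ y ∉ T) := by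
  by_cases hx : x ∈ T <;> by_cases hy : y ∈ T
  · rw [insert_inter_of_mem hx, singleton_inter_of_mem hy, card_insert_of_notMem (by simpa using hxy)]
    simp [hx, hy]
  · rw [insert_inter_of_mem hx, singleton_inter_of_notMem hy]
    simp [hx, hy]
  · rw [insert_inter_of_notMem hx, singleton_inter_of_mem hy]
    simp [hx, hy]
  · rw [insert_inter_of_notMem hx, singleton_inter_of_notMem hy]
    simp [hx, hy]

/-- SUBMODULARITY of crossing, pair by pair: `χ_{T₁∩T₂} + χ_{T₁∪T₂} ≤ χ_{T₁} + χ_{T₂}`. [cite: Balaban1983Higgs3, (1.21) p.416] -/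
theorem crossInd_submod {P : Finset Λ} (hP : P.card = 2) (T₁ T₂ : Finset Λ) :
    crossInd (T₁ ∩ T₂) P + crossInd (T₁ ∪ T₂) P ≤ crossInd T₁ P + crossInd T₂ P := by
  obtain ⟨x, y, hxy, rfl⟩ := card_eq_two.1 hP
  simp only [crossInd, card_pair_inter_eq_one_iff hxy, mem_inter, mem_union]
  by_cases h1 : x ∈ T₁ <;> by_cases h2 : x ∈ T₂ <;> by_cases h3 : y ∈ T₁ <;> by_cases h4 : y ∈ T₂ <;>
    simp [h1, h2, h3, h4]

/-- PARITY, pair by pair: `|P ∩ T| ≡ χ_T(P) (mod 2)` for a pair `P`. [cite: Balaban1983Higgs3, (1.21) p.416] -/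
theorem card_inter_mod_two {P : Finset Λ} (hP : P.card = 2) (T : Finset Λ) :
    (P ∩ T).card % 2 = crossInd T P := by
  obtain ⟨x, y, hxy, rfl⟩ := card_eq_two.1 hP
  have key : (({x, y} : Finset Λ) ∩ T).card % 2 = if (x ∈ T ↔ y ∉ T) then 1 else 0 := by
    by_cases hx : x ∈ T <;> by_cases hy : y ∈ T
    · rw [insert_inter_of_mem hx, singleton_inter_of_mem hy, card_insert_of_notMem (by simpa using hxy)]
      simp [hx, hy]
    · rw [insert_inter_of_mem hx, singleton_inter_of_notMem hy]
      simp [hx, hy]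
    · rw [insert_inter_of_notMem hx, singleton_inter_of_mem hy]
      simp [hx, hy]
    · rw [insert_inter_of_notMem hx, singleton_inter_of_notMem hy]
      simp [hx, hy]
  rw [key, crossInd]
  exact (if_congr (card_pair_inter_eq_one_iff hxy T).symm rfl rfl)

/-! ## §2 Amputated two-point pairings: cut counts, parity, submodularity, the first block -/

/-- The CUT COUNT of the leg set `T` for the amputated two-point pairing `(a, e, μ)` (`a` = the entry leg, joined to the external
point `x`; `e` = the exit leg, joined to `x′`; `μ` = the pairing of the other legs): the number of pairs of `μ` crossing `T`, plus one
if the entry line ends in `T`, plus one if the exit line starts in `T`. [cite: Balaban1983Higgs3, (1.21) p.416] -/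
def cut (μ : Finset (Finset Λ)) (a e : Λ) (T : Finset Λ) : ℕ :=
  (∑ P ∈ μ, crossInd T P) + (if a ∈ T then 1 else 0) + (if e ∈ T then 1 else 0)

/-- SUBMODULARITY of the cut count (all blocks of `μ` pairs). [cite: Balaban1983Higgs3, (1.21) p.416] -/
theorem cut_submod {μ : Finset (Finset Λ)} (hμ : ∀ P ∈ μ, P.card = 2) (a e : Λ) (T₁ T₂ : Finset Λ) :
    cut μ a e (T₁ ∩ T₂) + cut μ a e (T₁ ∪ T₂) ≤ cut μ a e T₁ + cut μ a e T₂ := by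
  have hs : ∑ P ∈ μ, crossInd (T₁ ∩ T₂) P + ∑ P ∈ μ, crossInd (T₁ ∪ T₂) P
      ≤ ∑ P ∈ μ, crossInd T₁ P + ∑ P ∈ μ, crossInd T₂ P := by
    rw [← sum_add_distrib, ← sum_add_distrib]
    exact sum_le_sum fun P hP => crossInd_submod (hμ P hP) T₁ T₂
  unfold cut
  by_cases h1 : a ∈ T₁ <;> by_cases h2 : a ∈ T₂ <;> by_cases h3 : e ∈ T₁ <;> by_cases h4 : e ∈ T₂ <;>
    simp only [mem_inter, mem_union, h1, h2, h3, h4] <;> simp <;> omega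

/-- The sum of `|P ∩ T|` over the blocks of a set partition of `X` is `|X ∩ T|`. [folklore] [cite: Balaban1983Higgs3, p.414] -/
theorem sum_card_inter_eq {X : Finset Λ} {μ : Finset (Finset Λ)} (hμ : IsSetPartition X μ) (T : Finset Λ) :
    ∑ P ∈ μ, (P ∩ T).card = (X ∩ T).card := by
  have hX : X ∩ T = μ.biUnion fun P => P ∩ T := by
    rw [← hμ.biUnion_id, biUnion_inter]; rfl
  rw [hX, card_biUnion]
  intro P hP Q hQ hne
  exact disjoint_of_subset_left inter_subset_left (disjoint_of_subset_right inter_subset_left (hμ.disjoint hP hQ hne))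

/-- PARITY of the cut count: `cut(T) ≡ |(X ∪ {a, e}) ∩ T| (mod 2)` for a perfect matching `μ` of `X` and `a ≠ e` outside `X`.
[cite: Balaban1983Higgs3, (1.21) p.416] -/
theorem cut_mod_two {X : Finset Λ} {μ : Finset (Finset Λ)} (hμ : IsPM X μ) {a e : Λ} (hne : a ≠ e) (ha : a ∉ X) (he : e ∉ X)
    (T : Finset Λ) : cut μ a e T % 2 = ((insert a (insert e X)) ∩ T).card % 2 := by
  have h1 : (∑ P ∈ μ, crossInd T P) % 2 = (X ∩ T).card % 2 := by
    have : ∑ P ∈ μ, crossInd T P = ∑ P ∈ μ, (P ∩ T).card % 2 :=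
      sum_congr rfl fun P hP => (card_inter_mod_two (hμ.2 P hP) T).symm
    rw [this, ← sum_nat_mod, sum_card_inter_eq hμ.1 T]
  have h2 : ((insert a (insert e X)) ∩ T).card
      = (X ∩ T).card + (if a ∈ T then 1 else 0) + (if e ∈ T then 1 else 0) := by
    by_cases haT : a ∈ T <;> by_cases heT : e ∈ T
    · rw [insert_inter_of_mem haT, insert_inter_of_mem heT, card_insert_of_notMem (by simp [hne, ha]),
        card_insert_of_notMem (by simp [he])]
      simp [haT, heT]
    · rw [insert_inter_of_mem haT, insert_inter_of_notMem heT, card_insert_of_notMem (by simp [ha])]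
      simp [haT, heT]
    · rw [insert_inter_of_notMem haT, insert_inter_of_mem heT, card_insert_of_notMem (by simp [he])]
      simp [haT, heT]
    · rw [insert_inter_of_notMem haT, insert_inter_of_notMem heT]
      simp [haT, heT]
  rw [h2]
  unfold cut
  split_ifs <;> omega

section Structure

variable (own : Λ → V) (A : Finset Λ)

/-- `(a, e, μ)` is an AMPUTATED TWO-POINT PAIRING on the vertex set `U`: the entry leg `a` and the exit leg `e` are two distinct
active legs of `U` and `μ` is a perfect matching of the other active legs of `U` (p. 414: the two external scalar fields
`φ(x)`, `φ(x′)` of (1.19) contract to `a` and `e`; all other legs *"are again divided into pairs"*; amputation = the two external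
propagators `C₀^ε(x, ·)`, `C₀^ε(·, x′)` are not part of the datum). [cite: Balaban1983Higgs3, (1.21) p.416] -/
structure IsAmp (U : Finset V) (a e : Λ) (μ : Finset (Finset Λ)) : Prop where
  /-- the entry leg is an active leg of `U` -/
  ha : a ∈ legsOf own A U
  /-- the exit leg is an active leg of `U` -/
  he : e ∈ legsOf own A U
  /-- they are distinct -/
  ne : a ≠ e
  /-- the other legs are perfectly matched -/
  pm : IsPM (legsOf own A U \ {a, e}) μ

/-- CONNECTED (p. 415 *"connected in the usual sense"*, with the two external points attached at `a` and `e`): every nonempty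
vertex set not containing the entry vertex is left by a line of `μ`. [cite: Balaban1983Higgs3, p.415] -/
def Conn (U : Finset V) (a : Λ) (μ : Finset (Finset Λ)) : Prop :=
  ∀ S ∈ U.powerset, S.Nonempty → own a ∉ S → ∃ P ∈ μ, (P ∩ legsOf own A S).card = 1

/-- The BLOCK FAMILY of `(a, e, μ)` on `U`: the vertex sets `S ∋ own a` with cut count `2` (the entry line and exactly one way
out). [cite: Balaban1983Higgs3, (1.21) p.416] -/
def blockFamily (U : Finset V) (a e : Λ) (μ : Finset (Finset Λ)) : Finset (Finset V) :=
  U.powerset.filter fun S => own a ∈ S ∧ cut μ a e (legsOf own A S) = 2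

/-- ONE-PARTICLE IRREDUCIBLE (p. 416 *"one-particle-irreducible graphs"*, for amputated two-point pairings): connected, and no
proper vertex subset containing the entry vertex has cut count `2` — no single internal line separates `x` from `x′`.
[cite: Balaban1983Higgs3, (1.21) p.416] -/
def OnePI (U : Finset V) (a e : Λ) (μ : Finset (Finset Λ)) : Prop :=
  Conn own A U a μ ∧ ∀ S ∈ U.powerset, own a ∈ S → cut μ a e (legsOf own A S) = 2 → S = U

/-- [folklore] [cite: Balaban1983Higgs3, (1.21) p.416] -/
instance (U : Finset V) (a : Λ) (μ : Finset (Finset Λ)) : Decidable (Conn own A U a μ) := by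
  unfold Conn; infer_instance

/-- [folklore] [cite: Balaban1983Higgs3, (1.21) p.416] -/
instance (U : Finset V) (a e : Λ) (μ : Finset (Finset Λ)) : Decidable (OnePI own A U a e μ) := by
  unfold OnePI; exact instDecidableAnd

/-- The FIRST BLOCK of `(a, e, μ)` on `U`: the smallest member of the block family (the vertex set of the first
one-particle-irreducible piece met from `x`). [cite: Balaban1983Higgs3, (1.21) p.416] -/
def firstBlock (U : Finset V) (a e : Λ) (μ : Finset (Finset Λ)) : Finset V :=
  if h : (blockFamily own A U a e μ).Nonempty then (blockFamily own A U a e μ).inf' h id else U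

variable {own A}

/-- [cite: Balaban1983Higgs3, (1.21) p.416] -/
theorem mem_blockFamily {U : Finset V} {a e : Λ} {μ : Finset (Finset Λ)} {S : Finset V} :
    S ∈ blockFamily own A U a e μ ↔ S ⊆ U ∧ own a ∈ S ∧ cut μ a e (legsOf own A S) = 2 := by
  rw [blockFamily, mem_filter, mem_powerset]

/-- kernel: the whole vertex set has cut count `2` (the entry and the exit line). [cite: Balaban1983Higgs3, (1.21) p.416] -/
theorem cut_self {U : Finset V} {a e : Λ} {μ : Finset (Finset Λ)} (h : IsAmp own A U a e μ) :
    cut μ a e (legsOf own A U) = 2 := by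
  have h0 : ∑ P ∈ μ, crossInd (legsOf own A U) P = 0 := by
    refine sum_eq_zero fun P hP => ?_
    have hsub : P ⊆ legsOf own A U := (h.pm.1.subset hP).trans sdiff_subset
    rw [crossInd, inter_eq_left.2 hsub, h.pm.2 P hP]; simp
  simp [cut, h0, h.ha, h.he]

/-- kernel: `U` belongs to its block family. [cite: Balaban1983Higgs3, (1.21) p.416] -/
theorem self_mem_blockFamily {U : Finset V} {a e : Λ} {μ : Finset (Finset Λ)} (h : IsAmp own A U a e μ) :
    U ∈ blockFamily own A U a e μ :=
  mem_blockFamily.2 ⟨Subset.rfl, ((mem_legsOf own A).1 h.ha).2, cut_self h⟩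

/-- kernel: under even degrees every cut count of a vertex subset is EVEN. [cite: Balaban1983Higgs3, (1.21) p.416] -/
theorem even_cut {U : Finset V} {a e : Λ} {μ : Finset (Finset Λ)} (h : IsAmp own A U a e μ)
    (hdeg : ∀ v ∈ U, Even (A.filter fun l => own l = v).card) {S : Finset V} (hS : S ⊆ U) :
    Even (cut μ a e (legsOf own A S)) := by
  have hX : insert a (insert e (legsOf own A U \ {a, e})) = legsOf own A U := by
    ext l
    simp only [mem_insert, mem_sdiff, mem_singleton]
    constructor
    · rintro (rfl | rfl | ⟨hl, -⟩)
      exacts [h.ha, h.he, hl]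
    · intro hl
      by_cases h1 : l = a
      · exact Or.inl h1
      by_cases h2 : l = e
      · exact Or.inr (Or.inl h2)
      exact Or.inr (Or.inr ⟨hl, fun h' => h'.elim h1 h2⟩)
  have hpar := cut_mod_two h.pm h.ne (by simp) (by simp) (legsOf own A S)
  rw [hX, inter_eq_right.2 (legsOf_mono own A hS)] at hpar
  rw [Nat.even_iff, hpar, ← Nat.even_iff]
  exact even_card_legsOf own A hdeg hS

/-- kernel: a vertex set containing the entry vertex has POSITIVE cut count. [cite: Balaban1983Higgs3, (1.21) p.416] -/
theorem one_le_cut {U : Finset V} {a e : Λ} {μ : Finset (Finset Λ)} (h : IsAmp own A U a e μ) {S : Finset V}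
    (haS : own a ∈ S) : 1 ≤ cut μ a e (legsOf own A S) := by
  have : a ∈ legsOf own A S := (mem_legsOf own A).2 ⟨((mem_legsOf own A).1 h.ha).1, haS⟩
  unfold cut
  rw [if_pos this]
  split_ifs <;> omega

/-- kernel: hence, under even degrees, it has cut count AT LEAST `2`. [cite: Balaban1983Higgs3, (1.21) p.416] -/
theorem two_le_cut {U : Finset V} {a e : Λ} {μ : Finset (Finset Λ)} (h : IsAmp own A U a e μ)
    (hdeg : ∀ v ∈ U, Even (A.filter fun l => own l = v).card) {S : Finset V} (hS : S ⊆ U) (haS : own a ∈ S) :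
    2 ≤ cut μ a e (legsOf own A S) := by
  have h1 := one_le_cut h haS
  obtain ⟨k, hk⟩ := even_cut h hdeg hS
  omega

/-- **The block family is closed under intersection** (submodularity + parity). [cite: Balaban1983Higgs3, (1.21) p.416] -/
theorem inter_mem_blockFamily {U : Finset V} {a e : Λ} {μ : Finset (Finset Λ)} (h : IsAmp own A U a e μ)
    (hdeg : ∀ v ∈ U, Even (A.filter fun l => own l = v).card) {S T : Finset V}
    (hS : S ∈ blockFamily own A U a e μ) (hT : T ∈ blockFamily own A U a e μ) : S ∩ T ∈ blockFamily own A U a e μ := by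
  obtain ⟨hSU, haS, hcS⟩ := mem_blockFamily.1 hS
  obtain ⟨hTU, haT, hcT⟩ := mem_blockFamily.1 hT
  have hsub := cut_submod h.pm.2 a e (legsOf own A S) (legsOf own A T)
  rw [← legsOf_inter, ← legsOf_union, hcS, hcT] at hsub
  have h2i := two_le_cut h hdeg (inter_subset_left.trans hSU) (mem_inter.2 ⟨haS, haT⟩)
  have h2u := two_le_cut h hdeg (union_subset hSU hTU) (mem_union_left _ haS)
  exact mem_blockFamily.2 ⟨inter_subset_left.trans hSU, mem_inter.2 ⟨haS, haT⟩, by omega⟩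

/-- kernel: the first block belongs to the block family. [cite: Balaban1983Higgs3, (1.21) p.416] -/
theorem firstBlock_mem {U : Finset V} {a e : Λ} {μ : Finset (Finset Λ)} (h : IsAmp own A U a e μ)
    (hdeg : ∀ v ∈ U, Even (A.filter fun l => own l = v).card) :
    firstBlock own A U a e μ ∈ blockFamily own A U a e μ := by
  have hne : (blockFamily own A U a e μ).Nonempty := ⟨U, self_mem_blockFamily h⟩
  rw [firstBlock, dif_pos hne]
  exact inf'_mem (↑(blockFamily own A U a e μ) : Set (Finset V))
    (fun S hS T hT => inter_mem_blockFamily h hdeg hS hT) _ hne id fun S hS => hS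

/-- kernel: the first block is contained in every member of the block family. [cite: Balaban1983Higgs3, (1.21) p.416] -/
theorem firstBlock_subset {U : Finset V} {a e : Λ} {μ : Finset (Finset Λ)} {S : Finset V}
    (hS : S ∈ blockFamily own A U a e μ) : firstBlock own A U a e μ ⊆ S := by
  have hne : (blockFamily own A U a e μ).Nonempty := ⟨S, hS⟩
  rw [firstBlock, dif_pos hne]
  exact inf'_le id hS

/-- kernel: the first block is a subset of `U` containing the entry vertex, of cut count `2`.
[cite: Balaban1983Higgs3, (1.21) p.416] -/
theorem firstBlock_spec {U : Finset V} {a e : Λ} {μ : Finset (Finset Λ)} (h : IsAmp own A U a e μ)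
    (hdeg : ∀ v ∈ U, Even (A.filter fun l => own l = v).card) :
    firstBlock own A U a e μ ⊆ U ∧ own a ∈ firstBlock own A U a e μ ∧ cut μ a e (legsOf own A (firstBlock own A U a e μ)) = 2 :=
  mem_blockFamily.1 (firstBlock_mem h hdeg)

/-- **A connected amputated pairing is one-particle irreducible iff its first block is the whole vertex set.**
[cite: Balaban1983Higgs3, (1.21) p.416] -/
theorem onePI_iff_firstBlock_eq {U : Finset V} {a e : Λ} {μ : Finset (Finset Λ)} (h : IsAmp own A U a e μ)
    (hdeg : ∀ v ∈ U, Even (A.filter fun l => own l = v).card) (hc : Conn own A U a μ) :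
    OnePI own A U a e μ ↔ firstBlock own A U a e μ = U := by
  constructor
  · intro h1
    obtain ⟨hBU, haB, hcB⟩ := firstBlock_spec h hdeg
    exact h1.2 _ (mem_powerset.2 hBU) haB hcB
  · intro hB
    refine ⟨hc, fun S hS haS hcS => ?_⟩
    have hsub := firstBlock_subset (mem_blockFamily.2 ⟨mem_powerset.1 hS, haS, hcS⟩)
    rw [hB] at hsub
    exact Subset.antisymm (mem_powerset.1 hS) hsub

end Structure

/-! ## §3 Gluing a one-particle-irreducible piece to a remainder along one line, and cutting it back -/

section Glue

variable {own : Λ → V} {A : Finset Λ}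

/-- An element of a finset, with default `d` (used on singletons only). [folklore] [cite: Balaban1983Higgs3, (1.21) p.416] -/
noncomputable def pick (s : Finset Λ) (d : Λ) : Λ := if h : s.Nonempty then h.choose else d

omit [DecidableEq Λ] in
/-- [folklore] [cite: Balaban1983Higgs3, (1.21) p.416] -/
theorem pick_singleton (x d : Λ) : pick {x} d = x := by
  have h : ({x} : Finset Λ).Nonempty := singleton_nonempty x
  rw [pick, dif_pos h]
  exact mem_singleton.1 h.choose_spec

/-- The pairs of `μ` crossing the leg set `T`. [cite: Balaban1983Higgs3, (1.21) p.416] -/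
def exitPairs (μ : Finset (Finset Λ)) (T : Finset Λ) : Finset (Finset Λ) := μ.filter fun P => (P ∩ T).card = 1

/-- [cite: Balaban1983Higgs3, (1.21) p.416] -/
theorem mem_exitPairs {μ : Finset (Finset Λ)} {T P : Finset Λ} : P ∈ exitPairs μ T ↔ P ∈ μ ∧ (P ∩ T).card = 1 := mem_filter

/-- kernel: the crossing part of the cut count is the number of crossing pairs. [cite: Balaban1983Higgs3, (1.21) p.416] -/
theorem sum_crossInd_eq_card (μ : Finset (Finset Λ)) (T : Finset Λ) : ∑ P ∈ μ, crossInd T P = (exitPairs μ T).card := by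
  unfold crossInd exitPairs
  rw [sum_boole, Nat.cast_id]

/-- The EXIT LEG through `T` (the endpoint inside `T` of the unique pair crossing `T`; junk otherwise). [cite: Balaban1983Higgs3, (1.21) p.416] -/
noncomputable def exitLeg (μ : Finset (Finset Λ)) (T : Finset Λ) (d : Λ) : Λ := pick ((exitPairs μ T).biUnion id ∩ T) d

/-- The NEXT ENTRY LEG after `T` (the endpoint outside `T` of the unique pair crossing `T`; junk otherwise).
[cite: Balaban1983Higgs3, (1.21) p.416] -/
noncomputable def nextLeg (μ : Finset (Finset Λ)) (T : Finset Λ) (d : Λ) : Λ := pick ((exitPairs μ T).biUnion id \ T) d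

/-- GLUING DATA: a vertex block `B ∋ own a` of `U` avoiding the exit vertex, an exit leg `e₁ ≠ a` of `B`, a next entry leg
`a₂ ≠ e` of `U ∖ B`, a perfect matching `μ₁` of the other legs of `B` and a perfect matching `μ₂` of the other legs of `U ∖ B`;
the glued pairing is `μ₁ ∪ μ₂ ∪ {{e₁, a₂}}` (the piece on `B`, the line `e₁—a₂`, the remainder). [cite: Balaban1983Higgs3, (1.21) p.416] -/
structure GlueData (own : Λ → V) (A : Finset Λ) (U : Finset V) (a e : Λ) (B : Finset V) (e₁ a₂ : Λ)
    (μ₁ μ₂ : Finset (Finset Λ)) : Prop where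
  /-- the block is a vertex subset -/
  hBU : B ⊆ U
  /-- the entry leg is a leg of the block -/
  ha : a ∈ legsOf own A B
  /-- the final exit leg is a leg of the complement -/
  he : e ∈ legsOf own A (U \ B)
  /-- the exit leg of the block -/
  he₁ : e₁ ∈ legsOf own A B
  /-- the entry leg of the remainder -/
  ha₂ : a₂ ∈ legsOf own A (U \ B)
  /-- distinct from the entry leg -/
  ne₁ : e₁ ≠ a
  /-- distinct from the final exit leg -/
  ne₂ : a₂ ≠ e
  /-- the piece's pairing -/
  pm₁ : IsPM (legsOf own A B \ {a, e₁}) μ₁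
  /-- the remainder's pairing -/
  pm₂ : IsPM (legsOf own A (U \ B) \ {a₂, e}) μ₂

/-- The glued pairing. [cite: Balaban1983Higgs3, (1.21) p.416] -/
def glued (e₁ a₂ : Λ) (μ₁ μ₂ : Finset (Finset Λ)) : Finset (Finset Λ) := insert {e₁, a₂} (μ₁ ∪ μ₂)

omit [DecidableEq Λ] in
/-- [cite: Balaban1983Higgs3, (1.21) p.416] -/
theorem legs_disjoint (own : Λ → V) (A : Finset Λ) (U B : Finset V) :
    Disjoint (legsOf own A B) (legsOf own A (U \ B)) := disjoint_legsOf own A disjoint_sdiff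

namespace GlueData

variable {U B : Finset V} {a e e₁ a₂ : Λ} {μ₁ μ₂ : Finset (Finset Λ)} (g : GlueData own A U a e B e₁ a₂ μ₁ μ₂)
include g

/-- [cite: Balaban1983Higgs3, (1.21) p.416] -/
theorem legs_union : legsOf own A B ∪ legsOf own A (U \ B) = legsOf own A U := by
  rw [← legsOf_union, union_sdiff_of_subset g.hBU]

/-- [cite: Balaban1983Higgs3, (1.21) p.416] -/
theorem e₁_ne_a₂ : e₁ ≠ a₂ := fun h => disjoint_left.1 (legs_disjoint own A U B) g.he₁ (h ▸ g.ha₂)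

/-- [cite: Balaban1983Higgs3, (1.21) p.416] -/
theorem a₂_notMem : a₂ ∉ legsOf own A B := fun h => disjoint_left.1 (legs_disjoint own A U B) h g.ha₂

/-- [cite: Balaban1983Higgs3, (1.21) p.416] -/
theorem e₁_notMem : e₁ ∉ legsOf own A (U \ B) := fun h => disjoint_left.1 (legs_disjoint own A U B) g.he₁ h

/-- [cite: Balaban1983Higgs3, (1.21) p.416] -/
theorem e_notMem : e ∉ legsOf own A B := fun h => disjoint_left.1 (legs_disjoint own A U B) h g.he

/-- [cite: Balaban1983Higgs3, (1.21) p.416] -/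
theorem a_notMem : a ∉ legsOf own A (U \ B) := fun h => disjoint_left.1 (legs_disjoint own A U B) g.ha h

/-- [cite: Balaban1983Higgs3, (1.21) p.416] -/
theorem card_line : ({e₁, a₂} : Finset Λ).card = 2 := Finset.card_pair g.e₁_ne_a₂

/-- [cite: Balaban1983Higgs3, (1.21) p.416] -/
theorem pair_inter_legsB : ({e₁, a₂} : Finset Λ) ∩ legsOf own A B = {e₁} := by
  rw [insert_inter_of_mem g.he₁, singleton_inter_of_notMem g.a₂_notMem]
  rfl

/-- [cite: Balaban1983Higgs3, (1.21) p.416] -/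
theorem pair_sdiff_legsB : ({e₁, a₂} : Finset Λ) \ legsOf own A B = {a₂} := by
  ext l
  simp only [mem_sdiff, mem_insert, mem_singleton]
  constructor
  · rintro ⟨rfl | rfl, h⟩
    · exact absurd g.he₁ h
    · rfl
  · rintro rfl; exact ⟨Or.inr rfl, g.a₂_notMem⟩

/-- blocks of the piece lie inside `L_B`. [cite: Balaban1983Higgs3, (1.21) p.416] -/
theorem subset_of_mem₁ {P : Finset Λ} (hP : P ∈ μ₁) : P ⊆ legsOf own A B := (g.pm₁.1.subset hP).trans sdiff_subset

/-- blocks of the remainder lie inside `L_{U∖B}`. [cite: Balaban1983Higgs3, (1.21) p.416] -/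
theorem subset_of_mem₂ {P : Finset Λ} (hP : P ∈ μ₂) : P ⊆ legsOf own A (U \ B) := (g.pm₂.1.subset hP).trans sdiff_subset

/-- [cite: Balaban1983Higgs3, (1.21) p.416] -/
theorem pair_notMem₁ : ({e₁, a₂} : Finset Λ) ∉ μ₁ := fun h => g.a₂_notMem (g.subset_of_mem₁ h (by simp))

/-- [cite: Balaban1983Higgs3, (1.21) p.416] -/
theorem pair_notMem₂ : ({e₁, a₂} : Finset Λ) ∉ μ₂ := fun h => g.e₁_notMem (g.subset_of_mem₂ h (by simp))

/-- [cite: Balaban1983Higgs3, (1.21) p.416] -/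
theorem pair_notMem : ({e₁, a₂} : Finset Λ) ∉ μ₁ ∪ μ₂ := by
  rw [mem_union, not_or]; exact ⟨g.pair_notMem₁, g.pair_notMem₂⟩

/-- [cite: Balaban1983Higgs3, (1.21) p.416] -/
theorem disjoint₁₂ : Disjoint μ₁ μ₂ := by
  refine disjoint_left.2 fun P h1 h2 => ?_
  obtain ⟨l, hl⟩ := g.pm₁.1.nonempty_of_mem h1
  exact disjoint_left.1 (legs_disjoint own A U B) (g.subset_of_mem₁ h1 hl) (g.subset_of_mem₂ h2 hl)

/-- **The glued pairing is a perfect matching of the legs of `U` other than `a`, `e`.** [cite: Balaban1983Higgs3, (1.21) p.416] -/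
theorem isPM_glued : IsPM (legsOf own A U \ {a, e}) (glued e₁ a₂ μ₁ μ₂) := by
  have hdisj : Disjoint (legsOf own A B \ {a, e₁}) (legsOf own A (U \ B) \ {a₂, e}) :=
    disjoint_of_subset_left sdiff_subset (disjoint_of_subset_right sdiff_subset (legs_disjoint own A U B))
  have hu := g.pm₁.1.union g.pm₂.1 hdisj
  have hP₀ : IsSetPartition ({e₁, a₂} : Finset Λ) {{e₁, a₂}} := isSetPartition_singleton (by simp)
  have hdisj' : Disjoint ({e₁, a₂} : Finset Λ) (legsOf own A B \ {a, e₁} ∪ (legsOf own A (U \ B) \ {a₂, e})) := by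
    rw [disjoint_union_right]
    constructor
    · refine disjoint_left.2 fun l hl hl' => ?_
      rcases mem_insert.1 hl with rfl | hl
      · simp at hl'
      · rw [mem_singleton.1 hl] at hl'; exact g.a₂_notMem (mem_sdiff.1 hl').1
    · refine disjoint_left.2 fun l hl hl' => ?_
      rcases mem_insert.1 hl with rfl | hl
      · exact g.e₁_notMem (mem_sdiff.1 hl').1
      · rw [mem_singleton.1 hl] at hl'; simp at hl'
  have hall := hP₀.union hu hdisj'
  have hX : ({e₁, a₂} : Finset Λ) ∪ (legsOf own A B \ {a, e₁} ∪ (legsOf own A (U \ B) \ {a₂, e})) = legsOf own A U \ {a, e} := by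
    rw [← g.legs_union]
    ext l
    simp only [mem_union, mem_sdiff, mem_insert, mem_singleton]
    constructor
    · rintro ((rfl | rfl) | ⟨h1, h2⟩ | ⟨h1, h2⟩)
      · exact ⟨Or.inl g.he₁, fun h => h.elim g.ne₁ fun h => g.e_notMem (h ▸ g.he₁)⟩
      · exact ⟨Or.inr g.ha₂, fun h => h.elim (fun h => g.a_notMem (h ▸ g.ha₂)) g.ne₂⟩
      · exact ⟨Or.inl h1, fun h => h.elim (fun h => h2 (Or.inl h)) fun h => g.e_notMem (h ▸ h1)⟩
      · exact ⟨Or.inr h1, fun h => h.elim (fun h => g.a_notMem (h ▸ h1)) fun h => h2 (Or.inr h)⟩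
    · rintro ⟨h1 | h1, h2⟩
      · by_cases hl : l = e₁
        · exact Or.inl (Or.inl hl)
        · exact Or.inr (Or.inl ⟨h1, fun h => h.elim (fun h => h2 (Or.inl h)) hl⟩)
      · by_cases hl : l = a₂
        · exact Or.inl (Or.inr hl)
        · exact Or.inr (Or.inr ⟨h1, fun h => h.elim hl fun h => h2 (Or.inr h)⟩)
  rw [hX] at hall
  refine ⟨?_, fun P hP => ?_⟩
  · rw [glued, insert_eq]; exact hall
  · rw [glued, mem_insert, mem_union] at hP
    rcases hP with rfl | hP | hP
    · exact g.card_line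
    · exact g.pm₁.2 P hP
    · exact g.pm₂.2 P hP

/-- kernel: the glued pairing is an amputated two-point pairing on `U`. [cite: Balaban1983Higgs3, (1.21) p.416] -/
theorem isAmp_glued : IsAmp own A U a e (glued e₁ a₂ μ₁ μ₂) where
  ha := g.legs_union ▸ mem_union_left _ g.ha
  he := g.legs_union ▸ mem_union_right _ g.he
  ne := fun h => g.a_notMem (h ▸ g.he)
  pm := g.isPM_glued

/-- **The product of the pair weights factorizes**: piece × the glued line × remainder. [cite: Balaban1983Higgs3, (1.21) p.416] -/
theorem prod_glued {R : Type*} [CommMonoid R] (w : Finset Λ → R) :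
    ∏ P ∈ glued e₁ a₂ μ₁ μ₂, w P = w {e₁, a₂} * ((∏ P ∈ μ₁, w P) * ∏ P ∈ μ₂, w P) := by
  rw [glued, prod_insert g.pair_notMem, prod_union g.disjoint₁₂]

/-- kernel: the only pair of the glued pairing crossing `L_B` is the glued line. [cite: Balaban1983Higgs3, (1.21) p.416] -/
theorem exitPairs_glued : exitPairs (glued e₁ a₂ μ₁ μ₂) (legsOf own A B) = {{e₁, a₂}} := by
  ext P
  rw [mem_exitPairs, glued, mem_insert, mem_union, mem_singleton]
  constructor
  · rintro ⟨rfl | hP | hP, hc⟩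
    · rfl
    · rw [inter_eq_left.2 (g.subset_of_mem₁ hP), g.pm₁.2 P hP] at hc; exact absurd hc (by decide)
    · rw [disjoint_iff_inter_eq_empty.1 (disjoint_of_subset_left (g.subset_of_mem₂ hP) (legs_disjoint own A U B).symm),
        card_empty] at hc
      exact absurd hc (by decide)
  · rintro rfl
    exact ⟨Or.inl rfl, by rw [g.pair_inter_legsB, card_singleton]⟩

/-- kernel: the exit leg of the glued pairing through `L_B` is `e₁`. [cite: Balaban1983Higgs3, (1.21) p.416] -/
theorem exitLeg_glued (d : Λ) : exitLeg (glued e₁ a₂ μ₁ μ₂) (legsOf own A B) d = e₁ := by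
  rw [exitLeg, g.exitPairs_glued, singleton_biUnion, id, g.pair_inter_legsB, pick_singleton]

/-- kernel: the next entry leg of the glued pairing after `L_B` is `a₂`. [cite: Balaban1983Higgs3, (1.21) p.416] -/
theorem nextLeg_glued (d : Λ) : nextLeg (glued e₁ a₂ μ₁ μ₂) (legsOf own A B) d = a₂ := by
  rw [nextLeg, g.exitPairs_glued, singleton_biUnion, id, g.pair_sdiff_legsB, pick_singleton]

/-- kernel: the blocks of the glued pairing inside `L_B` are the piece. [cite: Balaban1983Higgs3, (1.21) p.416] -/
theorem filter_glued₁ : (glued e₁ a₂ μ₁ μ₂).filter (fun P => P ⊆ legsOf own A B) = μ₁ := by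
  ext P
  rw [mem_filter, glued, mem_insert, mem_union]
  constructor
  · rintro ⟨rfl | hP | hP, hs⟩
    · exact absurd (hs (by simp)) g.a₂_notMem
    · exact hP
    · obtain ⟨l, hl⟩ := g.pm₂.1.nonempty_of_mem hP
      exact absurd (hs hl) fun h => disjoint_left.1 (legs_disjoint own A U B) h (g.subset_of_mem₂ hP hl)
  · intro hP; exact ⟨Or.inr (Or.inl hP), g.subset_of_mem₁ hP⟩

/-- kernel: the blocks of the glued pairing inside `L_{U∖B}` are the remainder. [cite: Balaban1983Higgs3, (1.21) p.416] -/
theorem filter_glued₂ : (glued e₁ a₂ μ₁ μ₂).filter (fun P => P ⊆ legsOf own A (U \ B)) = μ₂ := by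
  ext P
  rw [mem_filter, glued, mem_insert, mem_union]
  constructor
  · rintro ⟨rfl | hP | hP, hs⟩
    · exact absurd (hs (by simp)) g.e₁_notMem
    · obtain ⟨l, hl⟩ := g.pm₁.1.nonempty_of_mem hP
      exact absurd (hs hl) fun h => disjoint_left.1 (legs_disjoint own A U B) (g.subset_of_mem₁ hP hl) h
    · exact hP
  · intro hP; exact ⟨Or.inr (Or.inr hP), g.subset_of_mem₂ hP⟩

/-- **Cut counts inside the block are those of the piece**: for `S ⊆ B`, `cut_μ(L_S) = cut_{μ₁}(L_S)` (with exit leg `e₁`).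
[cite: Balaban1983Higgs3, (1.21) p.416] -/
theorem cut_glued_of_subset {S : Finset V} (hS : S ⊆ B) :
    cut (glued e₁ a₂ μ₁ μ₂) a e (legsOf own A S) = cut μ₁ a e₁ (legsOf own A S) := by
  have hLS : legsOf own A S ⊆ legsOf own A B := legsOf_mono own A hS
  have heS : e ∉ legsOf own A S := fun h => g.e_notMem (hLS h)
  have h2 : ∑ P ∈ μ₂, crossInd (legsOf own A S) P = 0 := by
    refine sum_eq_zero fun P hP => ?_
    rw [crossInd, disjoint_iff_inter_eq_empty.1
      (disjoint_of_subset_left (g.subset_of_mem₂ hP) (disjoint_of_subset_right hLS (legs_disjoint own A U B).symm)), card_empty]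
    simp
  have h0 : crossInd (legsOf own A S) {e₁, a₂} = if e₁ ∈ legsOf own A S then 1 else 0 := by
    have : a₂ ∉ legsOf own A S := fun h => g.a₂_notMem (hLS h)
    simp only [crossInd, card_pair_inter_eq_one_iff g.e₁_ne_a₂, this, not_false_eq_true, iff_true]
  unfold cut
  rw [glued, sum_insert g.pair_notMem, sum_union g.disjoint₁₂, h2, h0, if_neg heS]
  split_ifs <;> omega

/-- kernel: the block has cut count `2` in the glued pairing. [cite: Balaban1983Higgs3, (1.21) p.416] -/
theorem cut_glued_block : cut (glued e₁ a₂ μ₁ μ₂) a e (legsOf own A B) = 2 := by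
  rw [g.cut_glued_of_subset Subset.rfl]
  have hamp : IsAmp own A B a e₁ μ₁ := ⟨g.ha, g.he₁, g.ne₁.symm, g.pm₁⟩
  exact cut_self hamp

/-- kernel: the block belongs to the block family of the glued pairing. [cite: Balaban1983Higgs3, (1.21) p.416] -/
theorem block_mem_blockFamily : B ∈ blockFamily own A U a e (glued e₁ a₂ μ₁ μ₂) :=
  mem_blockFamily.2 ⟨g.hBU, ((mem_legsOf own A).1 g.ha).2, g.cut_glued_block⟩

end GlueData

end Glue

section GlueConn

variable {own : Λ → V} {A : Finset Λ}
variable {U B : Finset V} {a e e₁ a₂ : Λ} {μ₁ μ₂ : Finset (Finset Λ)}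

/-- kernel: for `B ⊆ U` and a pair `P` of legs of `U`, `|P ∩ L_B| + |P ∩ L_{U∖B}| = |P|`. [cite: Balaban1983Higgs3, (1.21) p.416] -/
theorem card_inter_add_card_inter {P : Finset Λ} (hP : P ⊆ legsOf own A U) (hBU : B ⊆ U) :
    (P ∩ legsOf own A B).card + (P ∩ legsOf own A (U \ B)).card = P.card := by
  rw [← card_union_of_disjoint (disjoint_of_subset_left inter_subset_right
    (disjoint_of_subset_right inter_subset_right (legs_disjoint own A U B))), ← inter_union_distrib_left,
    ← legsOf_union, union_sdiff_of_subset hBU, inter_eq_left.2 hP]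

namespace GlueData

variable (g : GlueData own A U a e B e₁ a₂ μ₁ μ₂)
include g

/-- **Gluing connected pieces gives a connected pairing.** [cite: Balaban1983Higgs3, p.415] -/
theorem conn_glued (h₁ : Conn own A B a μ₁) (h₂ : Conn own A (U \ B) a₂ μ₂) : Conn own A U a (glued e₁ a₂ μ₁ μ₂) := by
  intro S hS hne haS
  have hSU := mem_powerset.1 hS
  by_cases hSB : (S ∩ B).Nonempty
  · obtain ⟨P, hP, hc⟩ := h₁ (S ∩ B) (mem_powerset.2 inter_subset_right) hSB (fun h => haS (mem_inter.1 h).1)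
    refine ⟨P, by rw [glued, mem_insert, mem_union]; exact Or.inr (Or.inl hP), ?_⟩
    have heq : P ∩ legsOf own A (S ∩ B) = P ∩ legsOf own A S := by
      rw [legsOf_inter, inter_comm (legsOf own A S), ← inter_assoc, inter_eq_left.2 (g.subset_of_mem₁ hP)]
    rwa [heq] at hc
  · have hSB' : S ⊆ U \ B := by
      intro v hv
      exact mem_sdiff.2 ⟨hSU hv, fun hvB => hSB ⟨v, mem_inter.2 ⟨hv, hvB⟩⟩⟩
    by_cases ha₂S : own a₂ ∈ S
    · refine ⟨{e₁, a₂}, by rw [glued]; exact mem_insert_self _ _, ?_⟩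
      rw [card_pair_inter_eq_one_iff g.e₁_ne_a₂]
      have h1 : e₁ ∉ legsOf own A S := fun h =>
        hSB ⟨own e₁, mem_inter.2 ⟨((mem_legsOf own A).1 h).2, ((mem_legsOf own A).1 g.he₁).2⟩⟩
      have h2 : a₂ ∈ legsOf own A S := (mem_legsOf own A).2 ⟨((mem_legsOf own A).1 g.ha₂).1, ha₂S⟩
      simp [h1, h2]
    · obtain ⟨P, hP, hc⟩ := h₂ S (mem_powerset.2 hSB') hne ha₂S
      exact ⟨P, by rw [glued, mem_insert, mem_union]; exact Or.inr (Or.inr hP), hc⟩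

/-- **The remainder of a connected glued pairing is connected.** [cite: Balaban1983Higgs3, p.415] -/
theorem conn_rest (hc : Conn own A U a (glued e₁ a₂ μ₁ μ₂)) : Conn own A (U \ B) a₂ μ₂ := by
  intro S hS hne ha₂S
  have hSUB := mem_powerset.1 hS
  have hLS : legsOf own A S ⊆ legsOf own A (U \ B) := legsOf_mono own A hSUB
  have haS : own a ∉ S := fun h => (mem_sdiff.1 (hSUB h)).2 ((mem_legsOf own A).1 g.ha).2
  obtain ⟨P, hP, hcP⟩ := hc S (mem_powerset.2 (hSUB.trans sdiff_subset)) hne haS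
  rw [glued, mem_insert, mem_union] at hP
  rcases hP with rfl | hP | hP
  · rw [card_pair_inter_eq_one_iff g.e₁_ne_a₂] at hcP
    have h1 : e₁ ∉ legsOf own A S := fun h => g.e₁_notMem (hLS h)
    have h2 : a₂ ∉ legsOf own A S := fun h => ha₂S ((mem_legsOf own A).1 h).2
    exact absurd (hcP.2 h2) h1
  · rw [disjoint_iff_inter_eq_empty.1 (disjoint_of_subset_left (g.subset_of_mem₁ hP)
      (disjoint_of_subset_right hLS (legs_disjoint own A U B))), card_empty] at hcP
    exact absurd hcP (by decide)
  · exact ⟨P, hP, hcP⟩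

/-- **The piece of a connected glued pairing is connected** (parity: an odd number of further lines leaves any vertex set of
the block entered by the glued line). [cite: Balaban1983Higgs3, p.415] -/
theorem conn_piece (hdeg : ∀ v ∈ U, Even (A.filter fun l => own l = v).card) (hc : Conn own A U a (glued e₁ a₂ μ₁ μ₂)) :
    Conn own A B a μ₁ := by
  intro S hS hne haS
  have hSB := mem_powerset.1 hS
  have hLS : legsOf own A S ⊆ legsOf own A B := legsOf_mono own A hSB
  obtain ⟨P, hP, hcP⟩ := hc S (mem_powerset.2 (hSB.trans g.hBU)) hne haS
  rw [glued, mem_insert, mem_union] at hP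
  rcases hP with rfl | hP | hP
  · -- the glued line enters `S`: by parity another line of the piece leaves it
    rw [card_pair_inter_eq_one_iff g.e₁_ne_a₂] at hcP
    have h2 : a₂ ∉ legsOf own A S := fun h => g.a₂_notMem (hLS h)
    have h1 : e₁ ∈ legsOf own A S := hcP.2 h2
    have hev := even_cut g.isAmp_glued hdeg (hSB.trans g.hBU) (S := S)
    rw [g.cut_glued_of_subset hSB, cut, sum_crossInd_eq_card, if_pos h1,
      if_neg (fun h => haS ((mem_legsOf own A).1 h).2)] at hev
    have hpos : 0 < (exitPairs μ₁ (legsOf own A S)).card := by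
      rcases Nat.even_or_odd (exitPairs μ₁ (legsOf own A S)).card with h | h
      · exfalso
        obtain ⟨k, hk⟩ := h
        obtain ⟨m, hm⟩ := hev
        omega
      · exact h.pos
    obtain ⟨P', hP'⟩ := card_pos.1 hpos
    exact ⟨P', (mem_exitPairs.1 hP').1, (mem_exitPairs.1 hP').2⟩
  · exact ⟨P, hP, hcP⟩
  · rw [disjoint_iff_inter_eq_empty.1 (disjoint_of_subset_left (g.subset_of_mem₂ hP)
      (disjoint_of_subset_right hLS (legs_disjoint own A U B).symm)), card_empty] at hcP
    exact absurd hcP (by decide)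

/-- **If the piece is one-particle irreducible, the block IS the first block of the glued pairing.**
[cite: Balaban1983Higgs3, (1.21) p.416] -/
theorem firstBlock_glued (hdeg : ∀ v ∈ U, Even (A.filter fun l => own l = v).card) (h1 : OnePI own A B a e₁ μ₁) :
    firstBlock own A U a e (glued e₁ a₂ μ₁ μ₂) = B := by
  have hsub := firstBlock_subset g.block_mem_blockFamily
  obtain ⟨-, haB', hcB'⟩ := firstBlock_spec g.isAmp_glued hdeg
  rw [g.cut_glued_of_subset hsub] at hcB'
  exact h1.2 _ (mem_powerset.2 hsub) haB' hcB'

/-- conversely: **if the block is the first block of a connected glued pairing, the piece is one-particle irreducible.**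
[cite: Balaban1983Higgs3, (1.21) p.416] -/
theorem onePI_piece (hdeg : ∀ v ∈ U, Even (A.filter fun l => own l = v).card) (hc : Conn own A U a (glued e₁ a₂ μ₁ μ₂))
    (hB : firstBlock own A U a e (glued e₁ a₂ μ₁ μ₂) = B) : OnePI own A B a e₁ μ₁ := by
  refine ⟨g.conn_piece hdeg hc, fun S hS haS hcS => ?_⟩
  have hSB := mem_powerset.1 hS
  rw [← g.cut_glued_of_subset hSB] at hcS
  have hsub := firstBlock_subset (mem_blockFamily.2 ⟨hSB.trans g.hBU, haS, hcS⟩)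
  rw [hB] at hsub
  exact Subset.antisymm hSB hsub

/-- kernel: a glued pairing (exit vertex outside the block) is NOT one-particle irreducible.
[cite: Balaban1983Higgs3, (1.21) p.416] -/
theorem not_onePI_glued (hdeg : ∀ v ∈ U, Even (A.filter fun l => own l = v).card) :
    ¬ OnePI own A U a e (glued e₁ a₂ μ₁ μ₂) := by
  intro h1
  have hU := (onePI_iff_firstBlock_eq g.isAmp_glued hdeg h1.1).1 h1
  have hsub := firstBlock_subset g.block_mem_blockFamily
  rw [hU] at hsub
  exact (mem_sdiff.1 ((mem_legsOf own A).1 g.he).2).2 (hsub (mem_sdiff.1 ((mem_legsOf own A).1 g.he).2).1)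

end GlueData

end GlueConn

/-! ## §4 Cutting a connected, NOT one-particle-irreducible pairing at its first block -/

section Decompose

variable {own : Λ → V} {A : Finset Λ} {U : Finset V} {a e : Λ} {μ : Finset (Finset Λ)}

/-- **THE DECOMPOSITION.** A connected amputated two-point pairing that is not one-particle irreducible is the gluing of
its piece on the first block `B` (the pairs inside `L_B`, exit leg = the endpoint in `L_B` of the unique pair crossing `L_B`)
with its remainder on `U ∖ B` (entry leg = the other endpoint) along that pair. [cite: Balaban1983Higgs3, (1.21) p.416] -/
theorem decompose (h : IsAmp own A U a e μ) (hdeg : ∀ v ∈ U, Even (A.filter fun l => own l = v).card)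
    (hc : Conn own A U a μ) (hn : ¬ OnePI own A U a e μ) :
    GlueData own A U a e (firstBlock own A U a e μ)
      (exitLeg μ (legsOf own A (firstBlock own A U a e μ)) a) (nextLeg μ (legsOf own A (firstBlock own A U a e μ)) a)
      (μ.filter fun P => P ⊆ legsOf own A (firstBlock own A U a e μ))
      (μ.filter fun P => P ⊆ legsOf own A (U \ firstBlock own A U a e μ)) ∧
    glued (exitLeg μ (legsOf own A (firstBlock own A U a e μ)) a) (nextLeg μ (legsOf own A (firstBlock own A U a e μ)) a)
      (μ.filter fun P => P ⊆ legsOf own A (firstBlock own A U a e μ))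
      (μ.filter fun P => P ⊆ legsOf own A (U \ firstBlock own A U a e μ)) = μ := by
  obtain ⟨hBU, haB, hcB⟩ := firstBlock_spec h hdeg
  set B := firstBlock own A U a e μ with hBdef
  have hBne : B ≠ U := fun hB => hn ((onePI_iff_firstBlock_eq h hdeg hc).2 hB)
  have haA : a ∈ A := ((mem_legsOf own A).1 h.ha).1
  have haLB : a ∈ legsOf own A B := (mem_legsOf own A).2 ⟨haA, haB⟩
  have hPU : ∀ P ∈ μ, P ⊆ legsOf own A U := fun P hP => (h.pm.1.subset hP).trans sdiff_subset
  have hPX : ∀ P ∈ μ, ∀ l ∈ P, l ≠ a ∧ l ≠ e := fun P hP l hl => by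
    have := (mem_sdiff.1 (h.pm.1.subset hP hl)).2
    simpa [not_or] using this
  have hLU : legsOf own A B ∪ legsOf own A (U \ B) = legsOf own A U := by
    rw [← legsOf_union, union_sdiff_of_subset hBU]
  -- the number of pairs crossing `L_B`
  have hcount : (exitPairs μ (legsOf own A B)).card + (if e ∈ legsOf own A B then 1 else 0) = 1 := by
    have := hcB
    unfold cut at this
    rw [sum_crossInd_eq_card, if_pos haLB] at this
    omega
  -- the exit leg is not in the first block (else the first block would be closed, contradicting connectedness)
  have heB : e ∉ legsOf own A B := by
    intro heB
    rw [if_pos heB] at hcount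
    have h0 : exitPairs μ (legsOf own A B) = ∅ := card_eq_zero.1 (by omega)
    have hne : (U \ B).Nonempty := by
      rw [nonempty_iff_ne_empty, Ne, sdiff_eq_empty_iff_subset]
      exact fun hUB => hBne (Subset.antisymm hBU hUB)
    obtain ⟨P, hP, hcP⟩ := hc (U \ B) (mem_powerset.2 sdiff_subset) hne (fun h' => (mem_sdiff.1 h').2 haB)
    have hsum := card_inter_add_card_inter (hPU P hP) hBU
    rw [hcP, h.pm.2 P hP] at hsum
    have : P ∈ exitPairs μ (legsOf own A B) := mem_exitPairs.2 ⟨hP, by omega⟩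
    rw [h0] at this
    exact notMem_empty _ this
  rw [if_neg heB, add_zero] at hcount
  obtain ⟨P₀, hP₀⟩ := card_eq_one.1 hcount
  have hP₀mem : P₀ ∈ exitPairs μ (legsOf own A B) := by rw [hP₀]; exact mem_singleton_self _
  obtain ⟨hP₀μ, hP₀c⟩ := mem_exitPairs.1 hP₀mem
  have hP₀c' : (P₀ ∩ legsOf own A (U \ B)).card = 1 := by
    have := card_inter_add_card_inter (hPU P₀ hP₀μ) hBU
    rw [h.pm.2 P₀ hP₀μ] at this
    omega
  obtain ⟨e₁, he₁⟩ := card_eq_one.1 hP₀c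
  obtain ⟨a₂, ha₂⟩ := card_eq_one.1 hP₀c'
  -- identify the exit leg and the next entry leg
  have hsd : P₀ \ legsOf own A B = P₀ ∩ legsOf own A (U \ B) := by
    ext l
    simp only [mem_sdiff, mem_inter]
    constructor
    · rintro ⟨hl, hlB⟩
      have hlU := hPU P₀ hP₀μ hl
      rw [← hLU, mem_union] at hlU
      exact ⟨hl, hlU.resolve_left hlB⟩
    · rintro ⟨hl, hl2⟩
      exact ⟨hl, fun hlB => disjoint_left.1 (legs_disjoint own A U B) hlB hl2⟩
  have hexit : exitLeg μ (legsOf own A B) a = e₁ := by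
    rw [exitLeg, hP₀, singleton_biUnion, id, he₁, pick_singleton]
  have hnext : nextLeg μ (legsOf own A B) a = a₂ := by
    rw [nextLeg, hP₀, singleton_biUnion, id, hsd, ha₂, pick_singleton]
  rw [hexit, hnext]
  -- the crossing pair is `{e₁, a₂}`
  have he₁P : e₁ ∈ P₀ ∩ legsOf own A B := by rw [he₁]; exact mem_singleton_self _
  have ha₂P : a₂ ∈ P₀ ∩ legsOf own A (U \ B) := by rw [ha₂]; exact mem_singleton_self _
  have he₁B : e₁ ∈ legsOf own A B := (mem_inter.1 he₁P).2
  have ha₂B : a₂ ∈ legsOf own A (U \ B) := (mem_inter.1 ha₂P).2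
  have hP₀eq : P₀ = {e₁, a₂} := by
    rw [← inter_eq_left.2 (hPU P₀ hP₀μ), ← hLU, inter_union_distrib_left, he₁, ha₂, insert_eq]
  -- every other pair lies inside `L_B` or inside `L_{U∖B}`
  have hside : ∀ P ∈ μ, P ≠ P₀ → P ⊆ legsOf own A B ∨ P ⊆ legsOf own A (U \ B) := by
    intro P hP hne
    have hnot : (P ∩ legsOf own A B).card ≠ 1 := fun h1 => by
      have : P ∈ exitPairs μ (legsOf own A B) := mem_exitPairs.2 ⟨hP, h1⟩
      rw [hP₀, mem_singleton] at this
      exact hne this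
    have hsum := card_inter_add_card_inter (hPU P hP) hBU
    rw [h.pm.2 P hP] at hsum
    have hle : (P ∩ legsOf own A B).card ≤ 2 := by omega
    rcases Nat.lt_or_ge (P ∩ legsOf own A B).card 1 with hlt | hge
    · right
      have h2 : (P ∩ legsOf own A (U \ B)).card = 2 := by omega
      rw [← inter_eq_left, eq_of_subset_of_card_le inter_subset_left (by rw [h2, h.pm.2 P hP])]
    · left
      have h2 : (P ∩ legsOf own A B).card = 2 := by omega
      rw [← inter_eq_left, eq_of_subset_of_card_le inter_subset_left (by rw [h2, h.pm.2 P hP])]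
  -- assemble the gluing data
  have g : GlueData own A U a e B e₁ a₂ (μ.filter fun P => P ⊆ legsOf own A B)
      (μ.filter fun P => P ⊆ legsOf own A (U \ B)) := by
    refine ⟨hBU, haLB, ?_, he₁B, ha₂B, (hPX P₀ hP₀μ e₁ (mem_inter.1 he₁P).1).1, (hPX P₀ hP₀μ a₂ (mem_inter.1 ha₂P).1).2,
      ⟨⟨?_, ?_, ?_, ?_⟩, ?_⟩, ⟨⟨?_, ?_, ?_, ?_⟩, ?_⟩⟩
    · -- `e` is a leg of the complement
      have heU := h.he
      rw [← hLU, mem_union] at heU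
      exact heU.resolve_left heB
    · -- piece: blocks inside `L_B ∖ {a, e₁}`
      intro P hP
      obtain ⟨hPμ, hPB⟩ := mem_filter.1 hP
      intro l hl
      refine mem_sdiff.2 ⟨hPB hl, ?_⟩
      simp only [mem_insert, mem_singleton, not_or]
      refine ⟨(hPX P hPμ l hl).1, fun hle => ?_⟩
      subst hle
      have hPP : P = P₀ := h.pm.1.eq_of_mem hPμ hP₀μ hl (mem_inter.1 he₁P).1
      exact disjoint_left.1 (legs_disjoint own A U B) (hPB (hPP ▸ (mem_inter.1 ha₂P).1)) ha₂B
    · exact fun h0 => h.pm.1.2.1 (mem_filter.1 h0).1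
    · -- piece: cover
      intro l hl
      obtain ⟨hlB, hlne⟩ := mem_sdiff.1 hl
      simp only [mem_insert, mem_singleton, not_or] at hlne
      have hlX : l ∈ legsOf own A U \ {a, e} := by
        refine mem_sdiff.2 ⟨hLU ▸ mem_union_left _ hlB, ?_⟩
        simp only [mem_insert, mem_singleton, not_or]
        exact ⟨hlne.1, fun hle => heB (hle ▸ hlB)⟩
      obtain ⟨P, hP, hlP⟩ := h.pm.1.exists_mem hlX
      have hne : P ≠ P₀ := fun hPP => by
        have : l ∈ P₀ ∩ legsOf own A B := mem_inter.2 ⟨hPP ▸ hlP, hlB⟩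
        rw [he₁, mem_singleton] at this
        exact hlne.2 this
      rcases hside P hP hne with hs | hs
      · exact ⟨P, mem_filter.2 ⟨hP, hs⟩, hlP⟩
      · exact absurd (hs hlP) fun h2 => disjoint_left.1 (legs_disjoint own A U B) hlB h2
    · intro P hP Q hQ l hlP hlQ
      exact h.pm.1.eq_of_mem (mem_filter.1 hP).1 (mem_filter.1 hQ).1 hlP hlQ
    · exact fun P hP => h.pm.2 P (mem_filter.1 hP).1
    · -- remainder: blocks inside `L_{U∖B} ∖ {a₂, e}`
      intro P hP
      obtain ⟨hPμ, hPB⟩ := mem_filter.1 hP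
      intro l hl
      refine mem_sdiff.2 ⟨hPB hl, ?_⟩
      simp only [mem_insert, mem_singleton, not_or]
      refine ⟨fun hle => ?_, (hPX P hPμ l hl).2⟩
      subst hle
      have hPP : P = P₀ := h.pm.1.eq_of_mem hPμ hP₀μ hl (mem_inter.1 ha₂P).1
      exact disjoint_left.1 (legs_disjoint own A U B) he₁B (hPB (hPP ▸ (mem_inter.1 he₁P).1))
    · exact fun h0 => h.pm.1.2.1 (mem_filter.1 h0).1
    · -- remainder: cover
      intro l hl
      obtain ⟨hlB, hlne⟩ := mem_sdiff.1 hl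
      simp only [mem_insert, mem_singleton, not_or] at hlne
      have hlX : l ∈ legsOf own A U \ {a, e} := by
        refine mem_sdiff.2 ⟨hLU ▸ mem_union_right _ hlB, ?_⟩
        simp only [mem_insert, mem_singleton, not_or]
        exact ⟨fun hla => disjoint_left.1 (legs_disjoint own A U B) haLB (hla ▸ hlB), hlne.2⟩
      obtain ⟨P, hP, hlP⟩ := h.pm.1.exists_mem hlX
      have hne : P ≠ P₀ := fun hPP => by
        have : l ∈ P₀ ∩ legsOf own A (U \ B) := mem_inter.2 ⟨hPP ▸ hlP, hlB⟩
        rw [ha₂, mem_singleton] at this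
        exact hlne.1 this
      rcases hside P hP hne with hs | hs
      · exact absurd (hs hlP) fun h2 => disjoint_left.1 (legs_disjoint own A U B) h2 hlB
      · exact ⟨P, mem_filter.2 ⟨hP, hs⟩, hlP⟩
    · intro P hP Q hQ l hlP hlQ
      exact h.pm.1.eq_of_mem (mem_filter.1 hP).1 (mem_filter.1 hQ).1 hlP hlQ
    · exact fun P hP => h.pm.2 P (mem_filter.1 hP).1
  refine ⟨g, ?_⟩
  -- the gluing gives back `μ`
  ext P
  rw [glued, mem_insert, mem_union, mem_filter, mem_filter, ← hP₀eq]
  constructor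
  · rintro (rfl | ⟨hP, -⟩ | ⟨hP, -⟩)
    · exact hP₀μ
    · exact hP
    · exact hP
  · intro hP
    by_cases hne : P = P₀
    · exact Or.inl hne
    · rcases hside P hP hne with hs | hs
      · exact Or.inr (Or.inl ⟨hP, hs⟩)
      · exact Or.inr (Or.inr ⟨hP, hs⟩)

/-- kernel: hence its first block carries a ONE-PARTICLE-IRREDUCIBLE piece and its remainder is CONNECTED.
[cite: Balaban1983Higgs3, (1.21) p.416] -/
theorem onePI_piece_conn_rest (h : IsAmp own A U a e μ) (hdeg : ∀ v ∈ U, Even (A.filter fun l => own l = v).card)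
    (hc : Conn own A U a μ) (hn : ¬ OnePI own A U a e μ) :
    OnePI own A (firstBlock own A U a e μ) a (exitLeg μ (legsOf own A (firstBlock own A U a e μ)) a)
        (μ.filter fun P => P ⊆ legsOf own A (firstBlock own A U a e μ)) ∧
      Conn own A (U \ firstBlock own A U a e μ) (nextLeg μ (legsOf own A (firstBlock own A U a e μ)) a)
        (μ.filter fun P => P ⊆ legsOf own A (U \ firstBlock own A U a e μ)) := by
  obtain ⟨g, hμ⟩ := decompose h hdeg hc hn
  have hc' := hc
  rw [← hμ] at hc'
  exact ⟨g.onePI_piece hdeg hc' (by rw [hμ]), g.conn_rest hc'⟩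

end Decompose

/-! ## §5 The labelled first-block recursion for the sums over connected / one-particle-irreducible pairings -/

section Sums

variable (own : Λ → V) (A : Finset Λ) {R : Type*} [CommRing R] (w : Finset Λ → R)

/-- The CONNECTED amputated two-point pairings on `U` with entry leg `a` and exit leg `e`. [cite: Balaban1983Higgs3, (1.21) p.416] -/
def ampSet (U : Finset V) (a e : Λ) : Finset (Finset (Finset Λ)) :=
  (pmatchings (legsOf own A U \ {a, e})).filter fun μ => Conn own A U a μ

/-- The ONE-PARTICLE-IRREDUCIBLE amputated two-point pairings on `U` with entry leg `a` and exit leg `e`.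
[cite: Balaban1983Higgs3, (1.21) p.416] -/
def kerSet (U : Finset V) (a e : Λ) : Finset (Finset (Finset Λ)) :=
  (pmatchings (legsOf own A U \ {a, e})).filter fun μ => OnePI own A U a e μ

/-- `𝒜_U(a, e)`: the sum over the connected amputated two-point pairings of the product of the pair weights (the AMPUTATED
connected two-point coefficient with entry leg `a` and exit leg `e`, for pair weights `w` = propagators between the legs'
positions). [cite: Balaban1983Higgs3, (1.21) p.416] -/
def ampSum (U : Finset V) (a e : Λ) : R := ∑ μ ∈ ampSet own A U a e, ∏ P ∈ μ, w P

/-- `K_U(a, e)`: the same sum over the ONE-PARTICLE-IRREDUCIBLE pairings (the amputated 1PI kernel — print's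
`(−δm² + Σ^ε + …)` insertion, labelled and before summation over positions). [cite: Balaban1983Higgs3, (1.21) p.416] -/
def kerSum (U : Finset V) (a e : Λ) : R := ∑ μ ∈ kerSet own A U a e, ∏ P ∈ μ, w P

/-- The index set of the decomposition: blocks `B` (`own a ∈ B ⊆ U`, `own e ∉ B`), exit legs `e₁ ∈ L_B ∖ {a}`, next entry legs
`a₂ ∈ L_{U∖B} ∖ {e}`, 1PI pieces on `B`, connected remainders on `U ∖ B` (left-nested). [cite: Balaban1983Higgs3, (1.21) p.416] -/
def cutIndex (U : Finset V) (a e : Λ) :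
    Finset ((_ : (_ : (_ : (_ : Finset V) × Λ) × Λ) × Finset (Finset Λ)) × Finset (Finset Λ)) :=
  ((((U.powerset.filter fun B => own a ∈ B ∧ own e ∉ B).sigma fun B => (legsOf own A B).erase a).sigma
    fun x => (legsOf own A (U \ x.1)).erase e).sigma fun x => kerSet own A x.1.1 a x.1.2).sigma
    fun x => ampSet own A (U \ x.1.1.1) x.1.2 e

variable {own A}

/-- [cite: Balaban1983Higgs3, (1.21) p.416] -/
theorem mem_ampSet {U : Finset V} {a e : Λ} {μ : Finset (Finset Λ)} :
    μ ∈ ampSet own A U a e ↔ IsPM (legsOf own A U \ {a, e}) μ ∧ Conn own A U a μ := by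
  rw [ampSet, mem_filter, mem_pmatchings]

/-- [cite: Balaban1983Higgs3, (1.21) p.416] -/
theorem mem_kerSet {U : Finset V} {a e : Λ} {μ : Finset (Finset Λ)} :
    μ ∈ kerSet own A U a e ↔ IsPM (legsOf own A U \ {a, e}) μ ∧ OnePI own A U a e μ := by
  rw [kerSet, mem_filter, mem_pmatchings]

/-- kernel: the 1PI pairings are the connected pairings that are 1PI. [cite: Balaban1983Higgs3, (1.21) p.416] -/
theorem filter_onePI_ampSet (U : Finset V) (a e : Λ) :
    (ampSet own A U a e).filter (fun μ => OnePI own A U a e μ) = kerSet own A U a e := by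
  ext μ
  rw [mem_filter, mem_ampSet, mem_kerSet]
  exact ⟨fun h => ⟨h.1.1, h.2⟩, fun h => ⟨⟨h.1, h.2.1⟩, h.2⟩⟩

/-- **THE CUT BIJECTION AS A SUM IDENTITY**: the sum over the connected, not 1PI pairings of `Π w` equals the sum over
(block, exit leg, next entry leg, 1PI piece, connected remainder) of `w(line) · Π_piece w · Π_remainder w`.
[cite: Balaban1983Higgs3, (1.21) p.416] -/
theorem sum_not_onePI_eq_sum_cutIndex {U : Finset V} {a e : Λ} (hdeg : ∀ v ∈ U, Even (A.filter fun l => own l = v).card)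
    (ha : a ∈ legsOf own A U) (he : e ∈ legsOf own A U) (hne : a ≠ e) :
    ∑ μ ∈ (ampSet own A U a e).filter (fun μ => ¬ OnePI own A U a e μ), ∏ P ∈ μ, w P
      = ∑ x ∈ cutIndex own A U a e, w {x.1.1.1.2, x.1.1.2} * ((∏ P ∈ x.1.2, w P) * ∏ P ∈ x.2, w P) := by
  have haA : a ∈ A := ((mem_legsOf own A).1 ha).1
  have heA : e ∈ A := ((mem_legsOf own A).1 he).1
  have heU : own e ∈ U := ((mem_legsOf own A).1 he).2
  refine sum_nbij'
    (fun μ => ⟨⟨⟨⟨firstBlock own A U a e μ, exitLeg μ (legsOf own A (firstBlock own A U a e μ)) a⟩,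
      nextLeg μ (legsOf own A (firstBlock own A U a e μ)) a⟩,
      μ.filter fun P => P ⊆ legsOf own A (firstBlock own A U a e μ)⟩,
      μ.filter fun P => P ⊆ legsOf own A (U \ firstBlock own A U a e μ)⟩)
    (fun x => glued x.1.1.1.2 x.1.1.2 x.1.2 x.2) ?_ ?_ ?_ ?_ ?_
  · -- into the index set
    intro μ hμ
    obtain ⟨hμ, hn⟩ := mem_filter.1 hμ
    obtain ⟨hpm, hc⟩ := mem_ampSet.1 hμ
    have h : IsAmp own A U a e μ := ⟨ha, he, hne, hpm⟩
    obtain ⟨g, -⟩ := decompose h hdeg hc hn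
    obtain ⟨h1, h2⟩ := onePI_piece_conn_rest h hdeg hc hn
    simp only [cutIndex, mem_sigma, mem_filter, mem_powerset, mem_erase, mem_kerSet, mem_ampSet]
    exact ⟨⟨⟨⟨⟨g.hBU, ((mem_legsOf own A).1 g.ha).2, fun heB => (mem_sdiff.1 ((mem_legsOf own A).1 g.he).2).2 heB⟩,
      g.ne₁, g.he₁⟩, g.ne₂, g.ha₂⟩, g.pm₁, h1⟩, g.pm₂, h2⟩
  · -- from the index set
    rintro ⟨⟨⟨⟨B, e₁⟩, a₂⟩, μ₁⟩, μ₂⟩ hx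
    simp only [cutIndex, mem_sigma, mem_filter, mem_powerset, mem_erase, mem_kerSet, mem_ampSet] at hx
    obtain ⟨⟨⟨⟨⟨hBU, haB, heB⟩, hne₁, he₁⟩, hne₂, ha₂⟩, hpm₁, h1⟩, hpm₂, h2⟩ := hx
    have g : GlueData own A U a e B e₁ a₂ μ₁ μ₂ :=
      ⟨hBU, (mem_legsOf own A).2 ⟨haA, haB⟩, (mem_legsOf own A).2 ⟨heA, mem_sdiff.2 ⟨heU, heB⟩⟩, he₁, ha₂, hne₁, hne₂,
        hpm₁, hpm₂⟩
    refine mem_filter.2 ⟨mem_ampSet.2 ⟨g.isPM_glued, g.conn_glued h1.1 h2⟩, g.not_onePI_glued hdeg⟩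
  · -- left inverse
    intro μ hμ
    obtain ⟨hμ, hn⟩ := mem_filter.1 hμ
    obtain ⟨hpm, hc⟩ := mem_ampSet.1 hμ
    exact (decompose ⟨ha, he, hne, hpm⟩ hdeg hc hn).2
  · -- right inverse
    rintro ⟨⟨⟨⟨B, e₁⟩, a₂⟩, μ₁⟩, μ₂⟩ hx
    simp only [cutIndex, mem_sigma, mem_filter, mem_powerset, mem_erase, mem_kerSet, mem_ampSet] at hx
    obtain ⟨⟨⟨⟨⟨hBU, haB, heB⟩, hne₁, he₁⟩, hne₂, ha₂⟩, hpm₁, h1⟩, hpm₂, h2⟩ := hx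
    have g : GlueData own A U a e B e₁ a₂ μ₁ μ₂ :=
      ⟨hBU, (mem_legsOf own A).2 ⟨haA, haB⟩, (mem_legsOf own A).2 ⟨heA, mem_sdiff.2 ⟨heU, heB⟩⟩, he₁, ha₂, hne₁, hne₂,
        hpm₁, hpm₂⟩
    have hB := g.firstBlock_glued hdeg h1
    dsimp only
    rw [hB, g.exitLeg_glued, g.nextLeg_glued, g.filter_glued₁, g.filter_glued₂]
  · -- values
    intro μ hμ
    obtain ⟨hμ, hn⟩ := mem_filter.1 hμ
    obtain ⟨hpm, hc⟩ := mem_ampSet.1 hμ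
    obtain ⟨g, hglue⟩ := decompose ⟨ha, he, hne, hpm⟩ hdeg hc hn
    dsimp only
    rw [← g.prod_glued w, hglue]

/-- **THE FIRST-BLOCK RECURSION** (labelled form of print's chain structure (1.21): a connected amputated two-point graph is
either one-particle irreducible, or its first 1PI piece followed by one line `C₀` and a connected remainder):
`𝒜_U(a, e) = K_U(a, e) + Σ_{B, e₁, a₂} K_B(a, e₁) · w{e₁, a₂} · 𝒜_{U∖B}(a₂, e)`. [cite: Balaban1983Higgs3, (1.21) p.416] -/
theorem ampSum_eq_kerSum_add {U : Finset V} {a e : Λ} (hdeg : ∀ v ∈ U, Even (A.filter fun l => own l = v).card)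
    (ha : a ∈ legsOf own A U) (he : e ∈ legsOf own A U) (hne : a ≠ e) :
    ampSum own A w U a e = kerSum own A w U a e +
      ∑ B ∈ U.powerset.filter (fun B => own a ∈ B ∧ own e ∉ B), ∑ e₁ ∈ (legsOf own A B).erase a,
        ∑ a₂ ∈ (legsOf own A (U \ B)).erase e,
          w {e₁, a₂} * kerSum own A w B a e₁ * ampSum own A w (U \ B) a₂ e := by
  rw [ampSum, ← sum_filter_add_sum_filter_not (ampSet own A U a e) (fun μ => OnePI own A U a e μ), filter_onePI_ampSet,
    ← kerSum, sum_not_onePI_eq_sum_cutIndex w hdeg ha he hne]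
  congr 1
  rw [cutIndex, sum_sigma, sum_sigma, sum_sigma, sum_sigma]
  refine sum_congr rfl fun B _ => sum_congr rfl fun e₁ _ => sum_congr rfl fun a₂ _ => ?_
  dsimp only
  rw [mul_assoc, kerSum, ampSum, sum_mul_sum, mul_sum]
  refine sum_congr rfl fun μ₁ _ => ?_
  rw [mul_sum]

end Sums

end Literature.MathematicalPhysics.QuantumFieldTheory.Balaban1983to89.B3Eq121FirstBlock
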